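import Summits.QuantumFields.YangMills.Theorems.BalabanLadderNTCumulantPolarisationDefs
import Summits.QuantumFields.YangMills.Theorems.LangevinControlUVOSLegsFromFemtoAndGapStubCollar6
import Literature.Analysis.FluidPDE.HydrodynamicLimitProofs
import HarnessLib

/-!
# Crux `UVSeamRec` (stmt-QuantumFields-20043), v5(α) stub `stub_responseMomentsOdd6`: a FLOOR on the variance of the
# femto kernel's response from plain torus two-point data (LEAD `ym-spine-20043-p1` g9)

Helper file (`--supports stmt-QuantumFields-20043`).  The registered measure-side stub (RM) prices the RESPONSE of the
femto plane kernel `η ↦ kerE_Q^η(P)` (cube `Q = (c, b)`, `P` a plaquette field inside `Q`) to the sampled exterior; its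
singleton consequence is a CEILING on the torus variance `Var_T(kerE_Q(P)) ≤ E_T[(kerE_Q(P) − p)²] ≤ 2C₁²e^B/R⁸`
(`…ResponseMomentsTails`, `…CeilingsProductMomentsSecondOrder`).  This file records the elementary converse
direction, which is what a Monte-Carlo desk (or the floors side of the seam) can feed: for EVERY bounded continuous
cylinder spectator `H` reading no interior link of `Q`,

  `Cov_T(H, P)² ≤ Var_T(kerE_Q(P)) · Var_T(H)`       (`sq_torusCov_le_torusVar_kerE_mul`),

i.e. the response variance is bounded BELOW by the squared torus covariance of `P` with any exterior observable over
that observable's variance — plain two-point data, no kernel.  The proof is the one-sided torus DLR step WITH AN EXTERIOR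
SPECTATOR of the Markov–mirror file (`MarkovMirror.integral_mul_lift_eq_integral_mul_kerE`, p505063: `E_T[H·P] =
E_T[H·kerE_Q(P)]`), the one-cube DLR step `E_T[P] = E_T[kerE_Q(P)]`, and Cauchy–Schwarz on the odd torus
(`sq_torusCov_le_torusVar_mul`).  Specialised to the letters of (RM) (`sq_torusCov_plane_le_torusVar_kerE_plane_mul`):
for the cube of side `2R+3` around the plaquette `(q, x)` and any plaquette `(q', y)` one layer off the cube in some
coordinate direction, `Cov_T(P_{q'}(y), P_q(x))² ≤ Var_T(kerE_{x−(R+1),2R+3}(P_q(x))) · Var_T(P_{q'}(y))`.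
(`torusVar_le_torusE_centred_sq` ∕ `sq_torusCov_le_torusE_centred_sq_kerE_mul` give the mean-square form
`Cov_T(H, F)² ≤ E_T[(kerE_Q(F) − p')²]·Var_T(H)` that (RM)'s singleton clause bounds via `MarkovMirror.torusE_sq_le_of_expMoment`.)
Read together with the (RM) ceiling this is the located COMPATIBILITY CONDITION between the two halves of the seam:
a two-point FLOOR across the collar (NT side, `FC2`-type data `Cov ≳ c₂Γ/n⁸`) can never exceed the response CEILING
(`≲ C₁²e^B/R⁸ · Var P`) — consistent orders (`n ≥ R+2`), no tension; and it is the inequality by which sampled two-point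
tables give rigorous-in-expectation lower bounds on the (RM) variable's variance (LEAD g9 kit jobs j285321–j285345).

HONEST FRAMING: folklore probability (conditional-variance ≥ explained variance) written in the tree's torus∕kernel
vocabulary; nothing of E0′, NT or the gap; not Clay.

References: H.-O. Georgii, *Gibbs Measures and Phase Transitions* (2011) Rem. 1.24 (DLR with spectator); Cauchy–Schwarz.
-/

set_option autoImplicit false

noncomputable section

open MeasureTheory Filter Topology
open Literature.MathematicalPhysics.QuantumFieldTheory Literature.MathematicalPhysics.QuantumLattice
open Literature.Probability.LatticeModels
open Summit.QuantumFields.YangMills.Cruxes.OSLegsFromFemtoAndGap.DlrCollarTransfer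
open Summit.QuantumFields.YangMills.Cruxes.OSLegsFromFemtoAndGap.DlrCollarTransfer.StubLower (mem_cubeSites_iff)
open Summit.QuantumFields.YangMills.Cruxes.OSLegsAtWeakCouplingC.InheritedAmplitudeGates.StubInherit
  (integrable_lift integral_lift_eq_integral_kerE_cube)
open Summit.QuantumFields.YangMills.Cruxes.NT.MarkovMirror (integral_mul_lift_eq_integral_mul_kerE)
open Summit.QuantumFields.YangMills.Cruxes.NT.CumulantPolarisation (torusE_centred_centred)
open Summit.QuantumFields.YangMills.Cruxes.NT.Reference (continuous_kerE)
open Literature.Analysis.FluidPDE (sq_integral_mul_le_integral_sq_mul_integral_sq)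

namespace Summit.QuantumFields.YangMills.Cruxes.UVSeamRec.ResponseVariance

variable (G : Type) [Group G] [TopologicalSpace G] [IsTopologicalGroup G] [CompactSpace G]
  [MeasurableSpace G] [BorelSpace G] (r : LatticeRep G)

/-! ## §1 Cauchy–Schwarz for torus covariances -/

/-- **Cauchy–Schwarz on the odd torus, second-moment form**: for continuous observables `A`, `B`,
`E_T[A·B]² ≤ E_T[A·A] · E_T[B·B]`. [folklore] -/
theorem sq_torusE_mul_le (β : ℝ) (L : ℕ) {A B : LGConfig 4 G → ℝ} (hA : Continuous A) (hB : Continuous B) :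
    torusE G r β L (fun U => A U * B U) ^ 2 ≤
      torusE G r β L (fun U => A U * A U) * torusE G r β L (fun U => B U * B U) := by
  unfold torusE
  have hA2 : Integrable (fun U : GaugeConfig 4 (2 * L + 1) G => A (torusLift (2 * L + 1) U) ^ 2)
      (wilsonMeasure (d := 4) (L := 2 * L + 1) r.ρ β) := integrable_lift G r β (F := fun y => A y ^ 2) (hA.pow 2)
  have hB2 : Integrable (fun U : GaugeConfig 4 (2 * L + 1) G => B (torusLift (2 * L + 1) U) ^ 2)
      (wilsonMeasure (d := 4) (L := 2 * L + 1) r.ρ β) := integrable_lift G r β (F := fun y => B y ^ 2) (hB.pow 2)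
  have hAB : Integrable (fun U : GaugeConfig 4 (2 * L + 1) G => A (torusLift (2 * L + 1) U) * B (torusLift (2 * L + 1) U))
      (wilsonMeasure (d := 4) (L := 2 * L + 1) r.ρ β) := integrable_lift G r β (F := fun y => A y * B y) (hA.mul hB)
  have h := sq_integral_mul_le_integral_sq_mul_integral_sq hA2 hB2 hAB
  have eA : (fun U : GaugeConfig 4 (2 * L + 1) G => A (torusLift (2 * L + 1) U) * A (torusLift (2 * L + 1) U)) =
      fun U => A (torusLift (2 * L + 1) U) ^ 2 := funext fun U => (sq _).symm
  have eB : (fun U : GaugeConfig 4 (2 * L + 1) G => B (torusLift (2 * L + 1) U) * B (torusLift (2 * L + 1) U)) =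
      fun U => B (torusLift (2 * L + 1) U) ^ 2 := funext fun U => (sq _).symm
  rw [eA, eB]
  exact h

/-- **Cauchy–Schwarz for torus covariances**: for continuous observables `X`, `Y` on the odd torus,
`Cov_T(X, Y)² ≤ Var_T(X) · Var_T(Y)` (centre both observables and apply `sq_torusE_mul_le`). [folklore] -/
theorem sq_torusCov_le_torusVar_mul (β : ℝ) (L : ℕ) {X Y : LGConfig 4 G → ℝ} (hX : Continuous X)
    (hY : Continuous Y) :
    (torusE G r β L (fun U => X U * Y U) - torusE G r β L X * torusE G r β L Y) ^ 2 ≤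
      (torusE G r β L (fun U => X U * X U) - torusE G r β L X * torusE G r β L X) *
        (torusE G r β L (fun U => Y U * Y U) - torusE G r β L Y * torusE G r β L Y) := by
  set a := torusE G r β L X with ha
  set b := torusE G r β L Y with hb
  have hXc : Continuous fun U => X U - a := hX.sub continuous_const
  have hYc : Continuous fun U => Y U - b := hY.sub continuous_const
  have hXY : torusE G r β L (fun U => (X U - a) * (Y U - b)) = torusE G r β L (fun U => X U * Y U) - a * b := by
    rw [torusE_centred_centred G r β L hX hY a b, ← ha, ← hb]; ring
  have hXX : torusE G r β L (fun U => (X U - a) * (X U - a)) = torusE G r β L (fun U => X U * X U) - a * a := by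
    rw [torusE_centred_centred G r β L hX hX a a, ← ha]; ring
  have hYY : torusE G r β L (fun U => (Y U - b) * (Y U - b)) = torusE G r β L (fun U => Y U * Y U) - b * b := by
    rw [torusE_centred_centred G r β L hY hY b b, ← hb]; ring
  have h := sq_torusE_mul_le G r β L hXc hYc
  rw [hXY, hXX, hYY] at h
  exact h

/-- Torus variances are non-negative: `E_T[X]² ≤ E_T[X·X]` for a continuous observable. [folklore] -/
theorem torusE_sq_le_torusE_mul_self (β : ℝ) (L : ℕ) {X : LGConfig 4 G → ℝ} (hX : Continuous X) :
    torusE G r β L X ^ 2 ≤ torusE G r β L (fun U => X U * X U) := by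
  have h := sq_torusE_mul_le G r β L hX (continuous_const (y := (1 : ℝ)))
  have e1 : (fun U : LGConfig 4 G => X U * (1 : ℝ)) = X := funext fun U => mul_one _
  have e2 : torusE G r β L (fun _ : LGConfig 4 G => (1 : ℝ) * 1) = 1 := by
    haveI := r.secondCountableTopology
    haveI := isProbabilityMeasure_wilsonMeasure (d := 4) (L := 2 * L + 1) r.ρ r.continuous β
    unfold torusE
    rw [integral_const, smul_eq_mul, probReal_univ, one_mul, mul_one]
  rw [e1, e2, mul_one] at h
  exact h

/-! ## §2 The DLR transfer of a covariance with an exterior spectator -/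

/-- **DLR transfer of a torus covariance.**  Cube `Q = (c, b)` inside the odd torus of side `2L+1`
(`−L+1 ≤ cⱼ`, `cⱼ + b + 2 ≤ L+1`); `F` a bounded continuous cylinder observable with links based in the window
`[c, c+b]`; `H` a bounded continuous cylinder observable reading NO interior link of `Q`, supported in the window
`[−L+1, L−1]`.  Then `Cov_T(H, F) = Cov_T(H, kerE_Q(F))`: the spectator form of the torus DLR step
(`integral_mul_lift_eq_integral_mul_kerE`) for the mixed moment and the one-cube DLR step for the mean. [folklore] -/
theorem torusCov_eq_torusCov_kerE (β : ℝ) (c : Fin 4 → ℤ) (b L : ℕ)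
    (hc : ∀ j, -(L : ℤ) + 1 ≤ c j ∧ c j + (b : ℤ) + 2 ≤ (L : ℤ) + 1)
    {F H : LGConfig 4 G → ℝ} (hFc : Continuous F) (hHc : Continuous H) {MF MH : ℝ}
    (hMF : ∀ U, |F U| ≤ MF) (hMH : ∀ U, |H U| ≤ MH)
    {SF SH : Finset (Literature.MathematicalPhysics.QuantumLattice.ZdEdge 4)}
    (hFS : IsCylinder F SF) (hHS : IsCylinder H SH)
    (hSF : ∀ e ∈ SF, ∀ j, c j ≤ e.1 j ∧ e.1 j ≤ c j + b)
    (hSHoff : ∀ e ∈ SH, e ∉ cubeEdges c b)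
    (hSHwin : ∀ e ∈ SH, ∀ j, -(L : ℤ) + 1 ≤ e.1 j ∧ e.1 j ≤ (L : ℤ) - 1) :
    torusE G r β L (fun U => H U * F U) - torusE G r β L H * torusE G r β L F =
      torusE G r β L (fun η => H η * kerE G r β c b η F) -
        torusE G r β L H * torusE G r β L (fun η => kerE G r β c b η F) := by
  have hT : b + 3 ≤ 2 * L + 1 := by have := hc 0; omega
  have hc' : ∀ j, (fun _ : Fin 4 => -(L : ℤ)) j + 1 ≤ c j ∧
      c j + (b : ℤ) + 2 ≤ (fun _ : Fin 4 => -(L : ℤ)) j + (2 * L + 1 : ℕ) :=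
    fun j => ⟨(hc j).1, by push_cast; linarith [(hc j).2]⟩
  have hSHwin' : ∀ e ∈ SH, ∀ j, (fun _ : Fin 4 => -(L : ℤ)) j + 1 ≤ e.1 j ∧
      e.1 j + 2 ≤ (fun _ : Fin 4 => -(L : ℤ)) j + (2 * L + 1 : ℕ) :=
    fun e he j => ⟨(hSHwin e he j).1, by push_cast; linarith [(hSHwin e he j).2]⟩
  have h1 : torusE G r β L (fun U => H U * F U) = torusE G r β L (fun η => H η * kerE G r β c b η F) := by
    unfold torusE
    exact integral_mul_lift_eq_integral_mul_kerE G r β c b (2 * L + 1) (fun _ => -(L : ℤ)) hc' hFc hHc hMF hMH hFS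
      hHS hSF hSHoff hSHwin'
  have h2 : torusE G r β L F = torusE G r β L (fun η => kerE G r β c b η F) := by
    unfold torusE
    exact integral_lift_eq_integral_kerE_cube G r β c b (2 * L + 1) hT hFc hMF hFS hSF
  rw [h1, h2]

/-! ## §3 The response-variance floor -/

/-- **Response-variance floor from two-point data.**  In the setting of `torusCov_eq_torusCov_kerE`:
`Cov_T(H, F)² ≤ Var_T(kerE_Q(F)) · Var_T(H)` — the torus variance of the cube kernel's response `η ↦ kerE_Q^η(F)` is at
least the squared covariance of `F` with ANY exterior spectator over the spectator's variance (the variance EXPLAINED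
by `H`).  DLR transfer + Cauchy–Schwarz. [folklore] -/
theorem sq_torusCov_le_torusVar_kerE_mul (β : ℝ) (c : Fin 4 → ℤ) (b L : ℕ)
    (hc : ∀ j, -(L : ℤ) + 1 ≤ c j ∧ c j + (b : ℤ) + 2 ≤ (L : ℤ) + 1)
    {F H : LGConfig 4 G → ℝ} (hFc : Continuous F) (hHc : Continuous H) {MF MH : ℝ}
    (hMF : ∀ U, |F U| ≤ MF) (hMH : ∀ U, |H U| ≤ MH)
    {SF SH : Finset (Literature.MathematicalPhysics.QuantumLattice.ZdEdge 4)}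
    (hFS : IsCylinder F SF) (hHS : IsCylinder H SH)
    (hSF : ∀ e ∈ SF, ∀ j, c j ≤ e.1 j ∧ e.1 j ≤ c j + b)
    (hSHoff : ∀ e ∈ SH, e ∉ cubeEdges c b)
    (hSHwin : ∀ e ∈ SH, ∀ j, -(L : ℤ) + 1 ≤ e.1 j ∧ e.1 j ≤ (L : ℤ) - 1) :
    (torusE G r β L (fun U => H U * F U) - torusE G r β L H * torusE G r β L F) ^ 2 ≤
      (torusE G r β L (fun η => kerE G r β c b η F * kerE G r β c b η F) -
          torusE G r β L (fun η => kerE G r β c b η F) * torusE G r β L (fun η => kerE G r β c b η F)) *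
        (torusE G r β L (fun U => H U * H U) - torusE G r β L H * torusE G r β L H) := by
  rw [torusCov_eq_torusCov_kerE G r β c b L hc hFc hHc hMF hMH hFS hHS hSF hSHoff hSHwin]
  have hk : Continuous fun η => kerE G r β c b η F := continuous_kerE G r β c b hFc hMF
  exact (sq_torusCov_le_torusVar_mul G r β L hHc hk).trans_eq (mul_comm _ _)

/-- **Bias–variance**: the torus variance of a continuous observable is at most its mean square deviation from ANY
constant `p'`: `E_T[k·k] − E_T[k]² = E_T[(k − p')(k − p')] − (E_T[k] − p')² ≤ E_T[(k − p')(k − p')]`. [folklore] -/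
theorem torusVar_le_torusE_centred_sq (β : ℝ) (L : ℕ) {k : LGConfig 4 G → ℝ} (hk : Continuous k) (p' : ℝ) :
    torusE G r β L (fun U => k U * k U) - torusE G r β L k * torusE G r β L k ≤
      torusE G r β L (fun U => (k U - p') * (k U - p')) := by
  rw [torusE_centred_centred G r β L hk hk p' p']
  nlinarith [sq_nonneg (torusE G r β L k - p')]

/-- **Response floor against a mean-square response ceiling.**  In the setting of `torusCov_eq_torusCov_kerE`, for every
constant `p'`: `Cov_T(H, F)² ≤ E_T[(kerE_Q(F) − p')²] · Var_T(H)`.  This is the form a consumer of (RM) reads: (RM)'s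
singleton clause gives `E_T[(kerE_Q(P) − p)²] ≤ 2C₁²e^B∕λ²` with `λ = R⁴∕C₁` (`MarkovMirror.torusE_sq_le_of_expMoment`),
hence a CEILING `Cov_T(H, P)² ≤ (2C₁²e^B∕R⁸)·Var_T(H)` on every two-point function across the collar. [folklore] -/
theorem sq_torusCov_le_torusE_centred_sq_kerE_mul (β : ℝ) (c : Fin 4 → ℤ) (b L : ℕ)
    (hc : ∀ j, -(L : ℤ) + 1 ≤ c j ∧ c j + (b : ℤ) + 2 ≤ (L : ℤ) + 1)
    {F H : LGConfig 4 G → ℝ} (hFc : Continuous F) (hHc : Continuous H) {MF MH : ℝ}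
    (hMF : ∀ U, |F U| ≤ MF) (hMH : ∀ U, |H U| ≤ MH)
    {SF SH : Finset (Literature.MathematicalPhysics.QuantumLattice.ZdEdge 4)}
    (hFS : IsCylinder F SF) (hHS : IsCylinder H SH)
    (hSF : ∀ e ∈ SF, ∀ j, c j ≤ e.1 j ∧ e.1 j ≤ c j + b)
    (hSHoff : ∀ e ∈ SH, e ∉ cubeEdges c b)
    (hSHwin : ∀ e ∈ SH, ∀ j, -(L : ℤ) + 1 ≤ e.1 j ∧ e.1 j ≤ (L : ℤ) - 1) (p' : ℝ) :
    (torusE G r β L (fun U => H U * F U) - torusE G r β L H * torusE G r β L F) ^ 2 ≤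
      torusE G r β L (fun η => (kerE G r β c b η F - p') * (kerE G r β c b η F - p')) *
        (torusE G r β L (fun U => H U * H U) - torusE G r β L H * torusE G r β L H) := by
  have hk : Continuous fun η => kerE G r β c b η F := continuous_kerE G r β c b hFc hMF
  have hVH : 0 ≤ torusE G r β L (fun U => H U * H U) - torusE G r β L H * torusE G r β L H := by
    have := torusE_sq_le_torusE_mul_self G r β L hHc
    nlinarith
  calc _ ≤ _ := sq_torusCov_le_torusVar_kerE_mul G r β c b L hc hFc hHc hMF hMH hFS hHS hSF hSHoff hSHwin
    _ ≤ _ := mul_le_mul_of_nonneg_right (torusVar_le_torusE_centred_sq G r β L hk p') hVH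

/-! ## §4 In the letters of (RM): the centre plaquette of the cube of side `2R+3`, spectator = a plaquette off the cube -/

/-- The support of the single-plane field at `x` lies in the window `[c, c + b]` of the cube `c = x − (R+1)`,
`b = 2R+3`. [folklore] -/
theorem supp_plane_window (R : ℕ) (q : Fin 4 × Fin 4) (x : Fin 4 → ℤ) :
    ∀ e ∈ (originPlaquetteSupport q.1 q.2).image (fun e => (e.1 - -x, e.2)), ∀ j,
      (fun k => x k - ((R : ℤ) + 1)) j ≤ e.1 j ∧ e.1 j ≤ (fun k => x k - ((R : ℤ) + 1)) j + (2 * R + 3 : ℕ) := by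
  intro e he j
  have h := near_of_mem_supp_plane he j
  dsimp only
  push_cast
  constructor <;> linarith [h.1, h.2]

/-- A plaquette based at `y`, one full layer off the site range `[x − (R+1), x + (R+1)]` of the cube in some coordinate
direction (`y j₀ + 2 ≤ x j₀ − (R+1)` or `x j₀ + R + 2 ≤ y j₀`), reads no interior link of the cube. [folklore] -/
theorem supp_plane_off_cube {R : ℕ} (q' : Fin 4 × Fin 4) {x y : Fin 4 → ℤ}
    (hy : ∃ j : Fin 4, y j + 2 ≤ x j - ((R : ℤ) + 1) ∨ x j + (R : ℤ) + 2 ≤ y j) :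
    ∀ e ∈ (originPlaquetteSupport q'.1 q'.2).image (fun e => (e.1 - -y, e.2)),
      e ∉ cubeEdges (fun k => x k - ((R : ℤ) + 1)) (2 * R + 3) := by
  intro e he hmem
  obtain ⟨j₀, hj₀⟩ := hy
  have hnear := near_of_mem_supp_plane he j₀
  have hsite := (mem_cubeSites_iff _ _ _).1 (fst_mem_cubeSites_of_mem_cubeEdges hmem) j₀
  push_cast at hsite
  rcases hj₀ with h1 | h1 <;> omega

/-- **Response-variance floor in the letters of (RM).**  For `1 ≤ R`, a site `x` whose cube `(x − (R+1), 2R+3)` sits in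
the odd torus of side `2L+1` (`−L + R + 2 ≤ xⱼ`, `xⱼ + R + 4 ≤ L + 1`), an orientation `q`, and ANY plaquette `(q', y)` one
layer off the cube in some coordinate direction and inside the window `[−L+1, L−2]`:
`Cov_T(P_{q'}(y), P_q(x))² ≤ Var_T(kerE_{x−(R+1),2R+3}(P_q(x))) · Var_T(P_{q'}(y))`.
With the singleton consequence of (RM) (`Var_T(kerE(P)) ≤ 2C₁²e^B/R⁸` in these letters) this is the compatibility
condition «two-point floor across the collar ≤ response ceiling». [folklore] -/
theorem sq_torusCov_plane_le_torusVar_kerE_plane_mul (β : ℝ) (L R : ℕ) (q q' : Fin 4 × Fin 4) (x y : Fin 4 → ℤ)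
    (hx : ∀ j, -(L : ℤ) + R + 2 ≤ x j ∧ x j + (R : ℤ) + 4 ≤ (L : ℤ) + 1)
    (hy : ∃ j : Fin 4, y j + 2 ≤ x j - ((R : ℤ) + 1) ∨ x j + (R : ℤ) + 2 ≤ y j)
    (hywin : ∀ j, -(L : ℤ) + 1 ≤ y j ∧ y j + 1 ≤ (L : ℤ) - 1) :
    (torusE G r β L (fun U => plane G r q' y U * plane G r q x U) -
        torusE G r β L (plane G r q' y) * torusE G r β L (plane G r q x)) ^ 2 ≤
      (torusE G r β L (fun η => kerE G r β (fun k => x k - ((R : ℤ) + 1)) (2 * R + 3) η (plane G r q x) *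
            kerE G r β (fun k => x k - ((R : ℤ) + 1)) (2 * R + 3) η (plane G r q x)) -
          torusE G r β L (fun η => kerE G r β (fun k => x k - ((R : ℤ) + 1)) (2 * R + 3) η (plane G r q x)) *
            torusE G r β L (fun η => kerE G r β (fun k => x k - ((R : ℤ) + 1)) (2 * R + 3) η (plane G r q x))) *
        (torusE G r β L (fun U => plane G r q' y U * plane G r q' y U) -
          torusE G r β L (plane G r q' y) * torusE G r β L (plane G r q' y)) := by
  obtain ⟨C, hC⟩ := exists_abs_plane_le (G := G) r
  have hc : ∀ j, -(L : ℤ) + 1 ≤ (fun k => x k - ((R : ℤ) + 1)) j ∧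
      (fun k => x k - ((R : ℤ) + 1)) j + ((2 * R + 3 : ℕ) : ℤ) + 2 ≤ (L : ℤ) + 1 := by
    intro j; have := hx j; push_cast; constructor <;> linarith [this.1, this.2]
  have hywin' : ∀ e ∈ (originPlaquetteSupport q'.1 q'.2).image (fun e => (e.1 - -y, e.2)), ∀ j,
      -(L : ℤ) + 1 ≤ e.1 j ∧ e.1 j ≤ (L : ℤ) - 1 := by
    intro e he j
    have h := near_of_mem_supp_plane he j
    constructor <;> linarith [h.1, h.2, (hywin j).1, (hywin j).2]
  exact sq_torusCov_le_torusVar_kerE_mul G r β (fun k => x k - ((R : ℤ) + 1)) (2 * R + 3) L hc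
    (continuous_plane r q x) (continuous_plane r q' y) (hC q x) (hC q' y)
    (isCylinder_plane r q x) (isCylinder_plane r q' y) (supp_plane_window R q x)
    (supp_plane_off_cube q' hy) hywin'

end Summit.QuantumFields.YangMills.Cruxes.UVSeamRec.ResponseVariance

end
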